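import Summits.CriticalPhenomena.CardyFormulaZ2.Theorems.CardyComplexConeEdgePrecompactUFRSArms

/-!
# Where the two dynamics can differ: discrepancy edges touch the discrete boundaries
(line `qkz-strip-boundary-arm` of crux `CardyComplexCone.EdgePrecompact`, stmt-CriticalPhenomena-11387;
sharpening of item 2 of the road map for the uniform forward response stability "UFRS", module
docstring of `Theorems/CardyComplexConeEdgePrecompactUniformForwardResponseStability.lean`)

`ufrs_failureStructure` (`…EdgePrecompactUFRSFailureStructure.lean`) localises a forward-response
failure at a last synchronised corner `e` in the `3η`-collar, followed by a FACE or a SPLIT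
discrepancy. This file records the LATTICE-SCALE localisation, independent of `η`
(`ufrs_discrepancyEdges`, registered sub-goal):
* a SPLIT edge — an edge whose status differs in the completed configurations of the datum `E` and
  of its translate `E₁ = shiftData E w`, bordering faces inner for both — has an endpoint ON one of
  the four discrete arcs `A₀, B₀, A₁, B₁` (off the arcs both completed statuses are the `ω`-status:
  the completion only rewires edges touching the arcs); so the strands of `splitStrands` start at
  the discrete boundary itself, and the arms of item 3 run from scale `E.δ` at `∂Ω_δ ∪ ∂Ω₁_δ`;
* a FACE step — the `β₁`-orbit passing from an `E₁`-inner face to a non-inner one — crosses the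
  exit edge `e_b` of `E₁` (an `A₁B₁`-edge, closed, reached at its `A₁`-end), unless the orbit's
  start vertex lies on the free arc `B₁` (excluded in UFRS: a start corner sits on `A₁`, an exit
  corner of the ball is deep); this is `orbit_exit_or_stuck` of `…ResponseLocalisation.lean` read
  for the translate, and puts FACE discrepancies at the marked point `b_δ + E.δ w`;
* the vertex of a corner with inner face is a point of the domain (`meshPoint E.δ p.1 ∈ E.Ω`), the
  membership `z ∈ D.carrier` asked of the centres in hypothesis (H₁) of `ufrs_of_armDomination`.

References: S. Smirnov, C. R. Acad. Sci. Paris 333 (2001), §2; G. Grimmett, *Percolation* (1999),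
§11.2.
-/

namespace Summit.CriticalPhenomena.CardyFormulaZ2.Cruxes.EdgePrecompact.QkzStripBoundaryArm

open MeasureTheory Filter Set Metric
open scoped Topology BigOperators Pointwise
open Literature.Probability.LatticeModels Literature.Probability.Percolation
open Literature.Probability.RandomPlanarGeometry (DobrushinDomain)
open Summit.CriticalPhenomena.CardyFormulaZ2.Theses.CardyComplexCone

noncomputable section

/-- Off the arcs, the completed status of a domain edge is its `ω`-status. -/
theorem mem_bcBondConfig_iff_of_not_mem_arcs {E : DiscreteDobrushin} {ω : BondConfig (Site 2)}
    {e : Sym2 (Site 2)} (hdom : e ∈ (discreteDomainGraph E.Ω E.δ).edgeSet)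
    (harc : ∀ x ∈ e, x ∉ E.zdArcA ∧ x ∉ E.zdArcB) : e ∈ E.bcBondConfig ω ↔ e ∈ ω := by
  rw [DiscreteDobrushin.mem_bcBondConfig_iff]
  constructor
  · rintro ⟨-, hA | ⟨hω, -⟩⟩
    · induction e using Sym2.ind with
      | h x y => exact absurd (hA x (Sym2.mem_mk_left x y)) (harc x (Sym2.mem_mk_left x y)).1
    · exact hω
  · intro hω
    exact ⟨hdom, Or.inr ⟨hω, fun x hx => (harc x hx).2⟩⟩

/-- **Discrepancy edges touch the discrete boundaries** (registered sub-goal `ufrs_discrepancyEdges`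
of stmt-CriticalPhenomena-11387). For a datum `E`, a shift `w`, a configuration `ω` and a coded
corner `p`: (1) if the face of `p` is inner for `E` and for `shiftData E w` and the target edge of
`p` has different status in the two completed configurations, then some endpoint of that edge lies
on one of the four discrete arcs; (2) if `shiftData E w` is admissible, the face of the `k`-th corner
of the orbit of `c` in its completed configuration is inner for it and the face of the `(k+1)`-st is
not, and the vertex of `c` is not on its free arc, then the `k`-th target edge is closed, is an
`A`–`B` edge of `shiftData E w` reached at its `A`-end; (3) the vertex of a corner with `E`-inner
face is a point of `E.Ω`. -/
theorem ufrs_discrepancyEdges : ∀ (E : DiscreteDobrushin) (w : Site 2) (ω : BondConfig (Site 2)), (∀ p : Site 2 × Fin 4, E.IsInnerFace (cFace p) → (shiftData E w).IsInnerFace (cFace p) → ¬ (cTgt p ∈ E.bcBondConfig ω ↔ cTgt p ∈ (shiftData E w).bcBondConfig ω) → ∃ x ∈ cTgt p, x ∈ E.zdArcA ∨ x ∈ E.zdArcB ∨ x ∈ (shiftData E w).zdArcA ∨ x ∈ (shiftData E w).zdArcB) ∧ (∀ (c : Site 2 × Fin 4) (k : ℕ), (shiftData E w).IsZdAdmissible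 → (shiftData E w).IsInnerFace (cFace (cornerOrbit ((shiftData E w).bcBondConfig ω) c k)) → ¬ (shiftData E w).IsInnerFace (cFace (cornerOrbit ((shiftData E w).bcBondConfig ω) c (k + 1))) → c.1 ∉ (shiftData E w).zdArcB → cTgt (cornerOrbit ((shiftData E w).bcBondConfig ω) c k) ∉ (shiftData E w).bcBondConfig ω ∧ (cornerOrbit ((shiftData E w).bcBondConfig ω) c k).1 ∈ (shiftData E w).zdArcA ∧ (cornerOrbit ((shiftData E w).bcBondConfig ω) c k).1 + cornerUnit ((cornerOrbit ((shiftData E w).bcBondConfig ω) c k).2 + 1) ∈ (shiftData E w).zdArcB ∧ cTgt (cornerOrbit ((shiftData E w).bcBondConfig ω) c k) ∈ (shiftData E w).zdABEdges) ∧ (∀ p : Site 2 × Fin 4, E.IsInnerFace (cFace p) → meshPoint E.δ p.1 ∈ E.Ω) := by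
  intro E w ω
  refine ⟨fun p hp₀ hp₁ hne => ?_, fun c k hE₁ hin hout hcB => ?_, fun p hp =>
    meshPoint_mem_of_isCorner_of_isInnerFace (isCorner_cFace p) hp⟩
  · by_contra hno
    push Not at hno
    apply hne
    rw [mem_bcBondConfig_iff_of_not_mem_arcs (cTgt_mem_edgeSet_of_isInnerFace hp₀)
        fun x hx => ⟨(hno x hx).1, (hno x hx).2.1⟩,
      mem_bcBondConfig_iff_of_not_mem_arcs (cTgt_mem_edgeSet_of_isInnerFace hp₁)
        fun x hx => ⟨(hno x hx).2.2.1, (hno x hx).2.2.2⟩]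
  · rcases orbit_exit_or_stuck hE₁ ω c hin hout with ⟨hB, -⟩ | ⟨hclosed, hA, hB, -, hAB⟩
    · exact absurd hB hcB
    · exact ⟨hclosed, hA, hB, hAB⟩

end

end Summit.CriticalPhenomena.CardyFormulaZ2.Cruxes.EdgePrecompact.QkzStripBoundaryArm
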